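import Literature.NumberTheory.EllipticCurves.IsogenyCyclicKernelDiscriminantValuationProofs
import Literature.NumberTheory.EllipticCurves.GlobalMinimalModel
import HarnessLib

/-!
# Coates' lemma for an ARBITRARY Weierstrass model (in particular a globally minimal one):
# `Δ(E)ⁿ = Δ(E')·c¹²` and `n·v_p(Δ_min(E)) ≡ v_p(Δ_min(E')) (mod 12)` along a `K`-isogeny with
# cyclic kernel of order `n` prime to `6` (Dokchitser–Dokchitser 2015, Thm. 3 / Thm. 6; proofs only)

Topic `NumberTheory/EllipticCurves`; THEOREMS ONLY. `IsogenyCyclicKernelTwelfthPowerProofs` proves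
`Δ(E)ⁿ = Δ(E')·c¹²` (`c ∈ K`) for `E` in SHORT Weierstrass form. Globally minimal models are in
general not short; here the hypothesis is removed by the change of variables
`C = (1, -b₂/12, -a₁/2, a₁b₂/24 - a₃/2)` (`u = 1`: same `Δ`; `IsogenyPeriodLatticeProofs.shortChange_a₁_a₂_a₃`)
and the transport of the isogeny along the substitution isomorphism `C • E ≅ E`
(`exists_bijective_of_smul`):

* **`Isogeny.exists_Δ_pow_eq_mul_pow_twelve'`** — for ANY elliptic `E/K` (number field `K`) and a
  `K`-isogeny `φ : E → E'` with cyclic kernel `⟨P⟩` of order `n = 2m + 1` prime to `3`: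
  `∃ c ∈ K, Δ(E)ⁿ = Δ(E')·c¹²`;
* **`Isogeny.padicValInt_minimalDiscriminantInt_modEq_twelve`** — over `ℚ`, for globally minimal
  `E, E'`: `n·v_p(Δ_min(E)) ≡ v_p(Δ_min(E')) (mod 12)` at every prime `p` — the congruence
  `δ' ≡ pδ (mod 12)` of Dokchitser–Dokchitser 2015, Thm. 6, for every cyclic kernel of order
  prime to `6`.

## References
* [DokchitserDokchitser2015LocalInvariants] §2 Thm. 3, §3 Thm. 6.
* [SilvermanAEC2009] III.1 (changes of variables), VII/VIII (minimal models).
-/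

noncomputable section

open scoped Classical

open Finset

universe u

namespace WeierstrassCurve

namespace Isogeny

open Affine Affine.Point Literature.NumberTheory.EllipticCurves

variable {K : Type u} [Field K] [NumberField K] {W W' : WeierstrassCurve K}
  [W.IsElliptic] [W'.IsElliptic]

/-- **Coates' lemma / Dokchitser–Dokchitser 2015 Thm. 3 for an arbitrary model of `E`**: for a
`K`-isogeny `φ : E → E'` of elliptic curves over a number field `K` whose kernel is cyclic,
generated by `P = (x₀, y₀) ∈ E(K̄)` of exact order `n = 2m + 1` with `3 ∤ n`, there is `c ∈ K`
with `Δ(E)ⁿ = Δ(E')·c¹²` (the short-form hypothesis of `exists_Δ_pow_eq_mul_pow_twelve` removed by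
the `u = 1` change of variables to short form, which preserves `Δ`).
[cite: DokchitserDokchitser2015LocalInvariants, §2 Thm. 3 (Coates)] -/
theorem exists_Δ_pow_eq_mul_pow_twelve' (φ : Isogeny W W') {x₀ y₀ : AlgebraicClosure K}
    (h : (W⁄(AlgebraicClosure K)).toAffine.Nonsingular x₀ y₀) {n m : ℕ} (hnm : n = 2 * m + 1)
    (h3 : Nat.Coprime 3 n) (h1n : 1 < n) (hn : (n : ℤ) • Point.some x₀ y₀ h = 0)
    (hmin : ∀ k : ℕ, 0 < k → k < n → (k : ℤ) • Point.some x₀ y₀ h ≠ 0)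
    (hker : ∀ Q : W.geomPoints, Q ∈ φ.toAddMonoidHom.ker ↔
      Q ∈ (range n).image fun k : ℕ => (k : ℤ) • Point.some x₀ y₀ h) :
    ∃ c : K, W.Δ ^ n = W'.Δ * c ^ 12 := by
  haveI : Invertible (2 : K) := invertibleOfNonzero two_ne_zero
  haveI : Invertible (3 : K) := invertibleOfNonzero three_ne_zero
  set C : VariableChange K := ⟨1, -W.b₂ / 12, -W.a₁ / 2, W.a₁ * W.b₂ / 24 - W.a₃ / 2⟩ with hC
  obtain ⟨ha₁, ha₂, ha₃⟩ := shortChange_a₁_a₂_a₃ W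
  haveI : (C • W).IsShortNF := ⟨ha₁, ha₂, ha₃⟩
  have hΔ : (C • W).Δ = W.Δ := by rw [variableChange_Δ, hC]; simp
  -- transport the isogeny and the kernel generator along `e : C • W ≅ W`
  obtain ⟨e, he⟩ := exists_bijective_of_smul W C
  obtain ⟨P', hP'⟩ := he.2 (Point.some x₀ y₀ h)
  have hP'0 : P' ≠ 0 := by
    rintro rfl
    rw [_root_.map_zero] at hP'
    exact (Point.some_ne_zero h) hP'.symm
  obtain ⟨x₁, y₁, h₁, hP'eq⟩ : ∃ (x₁ y₁ : AlgebraicClosure K)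
      (h₁ : ((C • W)⁄(AlgebraicClosure K)).toAffine.Nonsingular x₁ y₁), P' = Point.some x₁ y₁ h₁ := by
    rcases P' with _ | ⟨x₁, y₁, h₁⟩
    · exact (hP'0 rfl).elim
    · exact ⟨x₁, y₁, h₁, rfl⟩
  subst hP'eq
  have hezsmul : ∀ k : ℤ, e (k • (Point.some x₁ y₁ h₁ : (C • W).geomPoints)) =
      k • (Point.some x₀ y₀ h : W.geomPoints) := fun k => by
    have hz := map_zsmul e k (Point.some x₁ y₁ h₁ : (C • W).geomPoints)
    exact hz.trans (congrArg (fun Q : W.geomPoints => k • Q) hP')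
  have hn' : (n : ℤ) • Point.some x₁ y₁ h₁ = 0 :=
    he.1 ((hezsmul n).trans (hn.trans (_root_.map_zero e).symm))
  have hmin' : ∀ k : ℕ, 0 < k → k < n → (k : ℤ) • Point.some x₁ y₁ h₁ ≠ 0 := by
    intro k hk hkn h0
    refine hmin k hk hkn ?_
    rw [← hezsmul k]
    exact (congrArg e h0).trans (_root_.map_zero e)
  have hker' : ∀ Q : (C • W).geomPoints, Q ∈ (φ.comp e).toAddMonoidHom.ker ↔
      Q ∈ (range n).image fun k : ℕ => (k : ℤ) • Point.some x₁ y₁ h₁ := by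
    intro Q
    have hmem : Q ∈ (φ.comp e).toAddMonoidHom.ker ↔ e Q ∈ φ.toAddMonoidHom.ker := by
      rw [AddMonoidHom.mem_ker, AddMonoidHom.mem_ker, coe_toAddMonoidHom, coe_toAddMonoidHom,
        comp_apply]
    rw [hmem, hker]
    constructor
    · intro hQ
      obtain ⟨k, hk, hkQ⟩ :=
        (Finset.mem_image (β := (W⁄(AlgebraicClosure K)).toAffine.Point)).mp hQ
      refine (Finset.mem_image (β := ((C • W)⁄(AlgebraicClosure K)).toAffine.Point)).mpr
        ⟨k, hk, he.1 ?_⟩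
      exact (hezsmul k).trans hkQ
    · intro hQ
      obtain ⟨k, hk, hkQ⟩ :=
        (Finset.mem_image (β := ((C • W)⁄(AlgebraicClosure K)).toAffine.Point)).mp hQ
      exact (Finset.mem_image (β := (W⁄(AlgebraicClosure K)).toAffine.Point)).mpr
        ⟨k, hk, (hezsmul k).symm.trans (congrArg e hkQ)⟩
  obtain ⟨c, hc⟩ := (φ.comp e).exists_Δ_pow_eq_mul_pow_twelve h₁ hnm h3 h1n hn' hmin' hker'
  exact ⟨c, by rw [← hΔ]; exact hc⟩

/-- **`n·v_p(Δ_min(E)) ≡ v_p(Δ_min(E')) (mod 12)`** for globally minimal elliptic curves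
`E, E'/ℚ` related by a `ℚ`-isogeny `φ : E → E'` with cyclic kernel `⟨P⟩` of order `n = 2m + 1`
prime to `3`, at every prime `p`: Dokchitser–Dokchitser 2015, Thm. 6 («`δ' ≡ pδ (mod 12)`»)
for every cyclic kernel of order prime to `6`, on the tree's minimal-discriminant currency
`padicValInt p W.minimalDiscriminantInt`.
[cite: DokchitserDokchitser2015LocalInvariants, §3 Thm. 6 (`δ' ≡ pδ mod 12`) with §2 Thm. 3] -/
theorem padicValInt_minimalDiscriminantInt_modEq_twelve {W W' : WeierstrassCurve ℚ}
    [W.IsElliptic] [W'.IsElliptic] [W.IsGloballyMinimal] [W'.IsGloballyMinimal]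
    (φ : Isogeny W W') {x₀ y₀ : AlgebraicClosure ℚ}
    (h : (W⁄(AlgebraicClosure ℚ)).toAffine.Nonsingular x₀ y₀) {n m : ℕ} (hnm : n = 2 * m + 1)
    (h3 : Nat.Coprime 3 n) (h1n : 1 < n) (hn : (n : ℤ) • Point.some x₀ y₀ h = 0)
    (hmin : ∀ k : ℕ, 0 < k → k < n → (k : ℤ) • Point.some x₀ y₀ h ≠ 0)
    (hker : ∀ Q : W.geomPoints, Q ∈ φ.toAddMonoidHom.ker ↔
      Q ∈ (range n).image fun k : ℕ => (k : ℤ) • Point.some x₀ y₀ h)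
    (p : ℕ) [Fact p.Prime] :
    (n : ℤ) * padicValInt p W.minimalDiscriminantInt ≡
      padicValInt p W'.minimalDiscriminantInt [ZMOD 12] := by
  obtain ⟨c, hc⟩ := φ.exists_Δ_pow_eq_mul_pow_twelve' h hnm h3 h1n hn hmin hker
  have hΔ : W.Δ ≠ 0 := W.isUnit_Δ.ne_zero
  have hΔ' : W'.Δ ≠ 0 := W'.isUnit_Δ.ne_zero
  have hc0 : c ≠ 0 := by
    rintro rfl
    rw [zero_pow (by norm_num), mul_zero] at hc
    exact pow_ne_zero n hΔ hc
  have hv := congrArg (padicValRat p) hc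
  rw [padicValRat.pow, padicValRat.mul hΔ' (pow_ne_zero 12 hc0), padicValRat.pow] at hv
  rw [← padicValRat.of_int, ← padicValRat.of_int, W.cast_minimalDiscriminantInt,
    W'.cast_minimalDiscriminantInt, Int.modEq_iff_dvd]
  exact ⟨-padicValRat p c, by push_cast at hv ⊢; linarith⟩

end Isogeny

end WeierstrassCurve
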